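import Summits.ResolutionOfSingularities.ResolutionOfSingularities.Theorems.WeightedInvariantLocalWeightedDropNCGameTotality
import Summits.ResolutionOfSingularities.ResolutionOfSingularities.Theorems.WeightedInvariantLocalWeightedDropPlaneNonNCCount
import Summits.ResolutionOfSingularities.ResolutionOfSingularities.Theorems.WeightedInvariantLocalWeightedDropMonomialPhaseChart

/-!
# `LocalWeightedDrop`, line `nc-game-transport`: `HTOT 1` IS A THEOREM — plane curve germs are won in the NC count game in finitely
# many rounds (every field), from the tree's strong embedded resolution of plane curve germs `planeGermNonNCCount`

[OURS · L1 W4.3 · chain w43, engine crux `LocalWeightedDrop` stmt-ResolutionOfSingularities-8899; strategist res-L1-w43-strat-1's line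
`nc-game-transport`, residual ladder `NCTransport.HTOT m` (…NCGameTotality: `HTOT 2` modulo ⟨F-32bR⟩, `HTOT m`, `m ≥ 3`, open in print);
res-type-088.]  Nothing here is a statement of any manuscript; the count game is the programme's own.  Closes no stub by name.

* `winsIn_plane` — over EVERY field, every non-zero `b ∈ k⟦x₀,x₁⟧` satisfies `∃ n, WinsIn GermIsNC n b`: play the point blow-up (weights
  `(1,1)`) as long as the support is not a normal crossing; the tree's count `planeGermNonNCCount` (p-id of record in …PlaneNonNCCount,
  the longest chain of non-normal-crossing infinitely near points) drops at every exceptional point, and `TupleGame.slice` IS the slice of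
  its clause (iii) (`rfl`).
* `htot_one : NCTransport.HTOT 1`, `countForm_one : NCTransport.CountForm 1` — the bottom rung of the residual ladder, unconditionally.
-/

set_option linter.dupNamespace false -- mandated namespace of this single-conjunct summit

namespace Summit.ResolutionOfSingularities.ResolutionOfSingularities.Theorems

namespace NCTransport

open MvPowerSeries Literature.AlgebraicGeometry.Resolution TameFourTupleDrop

/-- A plane germ with normal-crossing support in the tree's plane spelling (`u · x₀^a · x₁^c`) has `GermIsNC`. -/
theorem germIsNC_of_planeIsNC {k : Type} [Field k] {b : MvPowerSeries (Fin 2) k}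
    (h : ∃ (Φ : Fin 2 → MvPowerSeries (Fin 2) k) (u : MvPowerSeries (Fin 2) k) (a c : ℕ),
      (∀ i, MvPowerSeries.constantCoeff (Φ i) = 0) ∧
      IsUnit (Matrix.det (Matrix.of fun i j => MvPowerSeries.coeff (Finsupp.single j 1) (Φ i))) ∧
      MvPowerSeries.constantCoeff u ≠ 0 ∧ MvPowerSeries.subst Φ b = u * MvPowerSeries.X 0 ^ a * MvPowerSeries.X 1 ^ c) :
    GermIsNC b := by
  obtain ⟨Φ, u, a, c, hΦ0, hdet, hu, hb⟩ := h
  refine ⟨Φ, u, ![a, c], hΦ0, hdet, hu, ?_⟩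
  rw [hb, Fin.prod_univ_two]
  simp only [Matrix.cons_val_zero, Matrix.cons_val_one]
  ring

/-- **PLANE CURVE GERMS ARE WON IN THE NC COUNT GAME** (OURS · L1 W4.3): over every field, every non-zero `b ∈ k⟦x₀,x₁⟧` is brought to
normal-crossing support within finitely many rounds — by point blow-ups, the tree's `planeGermNonNCCount` supplying the terminating count. -/
theorem winsIn_plane (k : Type) [Field k] (b : MvPowerSeries (Fin 2) k) (hb : b ≠ 0) : ∃ n, WinsIn (m := 1) GermIsNC n b := by
  obtain ⟨ν, h1, -, h3⟩ := planeGermNonNCCount k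
  suffices main : ∀ (n : ℕ) (b : MvPowerSeries (Fin 2) k), b ≠ 0 → ν b ≤ n → WinsIn (m := 1) GermIsNC n b from
    ⟨ν b, main _ b hb le_rfl⟩
  intro n
  induction n with
  | zero =>
    intro b hb hle
    exact (winsIn_zero _ _).mpr (germIsNC_of_planeIsNC ((h1 b hb).mp (Nat.le_zero.mp hle)))
  | succ n ih =>
    intro b hb hle
    by_cases hnc : ∃ (Φ : Fin 2 → MvPowerSeries (Fin 2) k) (u : MvPowerSeries (Fin 2) k) (a c : ℕ),
        (∀ i, MvPowerSeries.constantCoeff (Φ i) = 0) ∧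
        IsUnit (Matrix.det (Matrix.of fun i j => MvPowerSeries.coeff (Finsupp.single j 1) (Φ i))) ∧
        MvPowerSeries.constantCoeff u ≠ 0 ∧ MvPowerSeries.subst Φ b = u * MvPowerSeries.X 0 ^ a * MvPowerSeries.X 1 ^ c
    · exact winsIn_done (germIsNC_of_planeIsNC hnc) _
    -- the point blow-up as the count game's move `(X, (1,1))`
    refine winsIn_move (Φ := fun i => (X i : MvPowerSeries (Fin 2) k)) (w := fun _ => 1)
      ⟨fun i => constantCoeff_X i, TupleMonomialPhase.isUnit_det_X, fun _ => le_rfl, ⟨0, one_pos⟩⟩ ?_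
    intro c hc hc0 A G hfac hG
    rw [MvPowerSeries.subst_self] at hfac
    simp only [id_eq] at hfac
    obtain ⟨i, hci, hlt⟩ := h3 b hb hnc c hc0 A G hfac hG
    refine ⟨i, hci, ih _ ?_ (by change ν (X 0 * TupleGame.slice i G) < ν b at hlt; omega)⟩
    exact mul_ne_zero (MvPowerSeries.prime_X' k (0 : Fin 2)).ne_zero
      (TupleDropAssembly.slice_ne_zero b (fun _ => 1) c hc (fun _ => le_rfl) A G hfac hG i hci)

/-- **`HTOT 1` HOLDS** — the bottom rung of the residual ladder of the line `nc-game-transport`, unconditionally. [OURS · L1 W4.3] -/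
theorem htot_one : HTOT 1 := fun _ _ k _ _ _ b hb => winsIn_plane k b hb

/-- Hence the ℕ-valued radical NC count with free smooth centres exists for plane germs in every prime characteristic
(`countForm_iff_htot`). -/
theorem countForm_one : CountForm 1 := countForm_of_htot 1 htot_one

end NCTransport

end Summit.ResolutionOfSingularities.ResolutionOfSingularities.Theorems
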